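import Literature.NumberTheory.Sieve.Maynard2016BadPrimes
import Literature.NumberTheory.Sieve.Maynard2016SingSeriesPos
import Literature.NumberTheory.Sieve.Maynard2016Lemma6Split

/-!
# Maynard (2016), Lemma 6: the arithmetic factor `N = ∏ (1 − (ω_{m,q}(p) − 2k)/p)` is the singular series ((6.16), (6.20))

Trunk: AntSieve / parity (Maynard 2016 large-gaps ladder, named fact
`Literature.NumberTheory.Sieve.Maynard2016.Lemma6MainTerm` of `Maynard2016Lemma6Split.lean`).

J. Maynard, *Large gaps between primes*, Ann. of Math. 183 (2016) = arXiv:1408.5110, §6, proof of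
Lemma 6, display (6.16) "`∏_{w<p≤y} (1 − (ω_{m,q}(p) − 2k)/p)`" and the last display of the proof,
"`𝔖_{m,q} = (1 + o_k(1)) ∏_{p ≤ x}(1 − ω_{m,q}(p)/p)(1 − 1/p)^{−2k}`" ((6.20)).
In the coupled Euler product `K = E · N · Z · Z'` of `Maynard2016CoupledProduct`
(`LcmEuler.coupledKernel_eq_prod`) the frequency-independent factor is
`N = LcmEuler.nuProd (P_w) m M Bad = ∏_{p ∈ Bad, p ∤ P_w} (1 + ν_p/p)`.  Here, for Maynard's data
(`M_p = couplingSet k x m q p`, `Bad = badPrimes k x m q` of `Maynard2016BadPrimes`), we PROVE: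
* `coupledNu_couplingSet_eq` — `ν_p = 2k − ω_{m,q}(p)` for primes `p ∤ q` not dividing any `h_j − h_i`
  (from `omegaMQ_add_card_couplingSet`);
* `nuProdReal_eq_mul` — `N = (∏_{w < p ≤ y} (1 − (ω_{m,q}(p) − 2k)/p)) · B` with the tail
  `1 ≤ B ≤ exp(k² #{p ∣ N'} /(⌊y⌋+1))` over the bad primes `> y`;
* `abs_ratio_sub_one_le` — `(1 − (ω−2k)/p) = (1 + O(k²/p²)) (1 − ω/p)(1 − 1/p)^{−2k}` for `p ≥ 4k`;
* `eventually_abs_nuProdReal_sub_singLarge_le` — **uniformly in `1 ≤ m ≤ x` and primes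
  `x/2 ≤ q ≤ x`: `|N − 𝔖^{(w,y]}_{m,q}| ≤ η 𝔖^{(w,y]}_{m,q}`** eventually in `x`, where
  `𝔖^{(w,y]}_{m,q} = singLarge k ε x m q = ∏_{w<p≤y}(1 − ω_{m,q}(p)/p)(1 − 1/p)^{−2k}`.

## References

* J. Maynard, *Large gaps between primes*, Ann. of Math. (2) 183 (2016), 915–933; arXiv:1408.5110,
  §6, proof of Lemma 6, displays (6.16), (6.20). [Maynard2016LargeGaps]
-/

noncomputable section

open Filter Finset
open scoped BigOperators Topology

namespace Literature.NumberTheory.Sieve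

namespace Maynard2016

open LcmEuler

/-! ### The primes `w < p ≤ y` and `ν_p = 2k − ω_{m,q}(p)` -/

/-- The primes in `(w, y]`. [cite: Maynard2016LargeGaps, §6 display (6.16)] -/
def midPrimes (ε : ℝ) (x : ℕ) : Finset ℕ := (Finset.Ioc ⌊wFun x⌋₊ ⌊y ε x⌋₊).filter Nat.Prime

/-- `singLarge` is the product over `midPrimes`. [cite: Maynard2016LargeGaps, §6 display (6.20)] -/
theorem singLarge_eq (k : ℕ) (ε : ℝ) (x m q : ℕ) :
    singLarge k ε x m q = ∏ p ∈ midPrimes ε x,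
      (1 - (omegaMQ k x m q p : ℝ) / p) * ((1 - 1 / (p : ℝ)) ^ (2 * k))⁻¹ := rfl

/-- A prime in `(w, y]` does not divide `P_w`. [cite: Maynard2016LargeGaps, §4 (definition of P_w)] -/
theorem not_dvd_Pw_of_mem_midPrimes {ε : ℝ} {x p : ℕ} (hp : p ∈ midPrimes ε x) :
    p.Prime ∧ ¬ p ∣ Pw x := by
  obtain ⟨hI, hpp⟩ := Finset.mem_filter.1 hp
  refine ⟨hpp, (Nat.Prime.coprime_iff_not_dvd hpp).1 (coprime_Pw_of_prime_gt hpp ?_)⟩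
  exact Nat.lt_of_floor_lt (Finset.mem_Ioc.1 hI).1

/-- **`ν_p = 2k − ω_{m,q}(p)`** for a prime `p ∤ q` dividing no `h_j − h_i` (`i ≠ j`).
[cite: Maynard2016LargeGaps, §6 display (6.16)] -/
theorem coupledNu_couplingSet_eq {k x m q p : ℕ} (hp : p.Prime) (hpq : ¬ p ∣ q)
    (hdist : ∀ i j : Fin k, i ≠ j → ¬ (p : ℤ) ∣ (hTuple k x j : ℤ) - hTuple k x i) :
    (coupledNu m (couplingSet k x m q) p : ℝ) = 2 * k - omegaMQ k x m q p := by
  have h := omegaMQ_add_card_couplingSet (k := k) (x := x) (m := m) (q := q) hp hpq hdist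
  unfold coupledNu
  by_cases hpm : p ∣ m
  · rw [if_pos hpm, Fintype.card_fin]
    rw [couplingSet_eq_empty_of_dvd hp hpm, Finset.card_empty, if_pos hpm] at h
    have : (omegaMQ k x m q p : ℝ) + k = 2 * k := by
      exact_mod_cast (show omegaMQ k x m q p + k = 2 * k by omega)
    linarith
  · rw [if_neg hpm]
    rw [if_neg hpm, add_zero] at h
    have : (omegaMQ k x m q p : ℝ) + (couplingSet k x m q p).card = 2 * k := by exact_mod_cast h
    linarith

/-- `ν_p ≤ k²`. [cite: Maynard2016LargeGaps, §6 display (6.13)] -/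
theorem coupledNu_couplingSet_le (k x m q p : ℕ) : coupledNu m (couplingSet k x m q) p ≤ k * k := by
  unfold coupledNu
  split_ifs
  · rw [Fintype.card_fin]; exact Nat.le_mul_self k
  · calc (couplingSet k x m q p).card ≤ (Finset.univ : Finset (Fin k × Fin k)).card :=
          Finset.card_le_univ _
      _ = k * k := by rw [Finset.card_univ, Fintype.card_prod, Fintype.card_fin]

/-! ### `N` as a real product, split at `y` -/

/-- `N` as a real number: `∏_{p ∈ Bad, p prime, p ∤ P_w} (1 + ν_p/p)`. [cite: Maynard2016LargeGaps, §6 display (6.16)] -/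
def nuProdReal (k x m q : ℕ) : ℝ :=
  ∏ p ∈ (badPrimes k x m q).filter (fun p => p.Prime ∧ ¬ p ∣ Pw x),
    (1 + (coupledNu m (couplingSet k x m q) p : ℝ) / p)

/-- `LcmEuler.nuProd = nuProdReal` (cast). [cite: Maynard2016LargeGaps, §6 display (6.16)] -/
theorem nuProd_eq_ofReal (k x m q : ℕ) :
    nuProd (Pw x) m (couplingSet k x m q) (badPrimes k x m q) = (nuProdReal k x m q : ℂ) := by
  unfold nuProd nuProdReal
  push_cast
  rfl

/-- The tail of `N` over the bad primes `> y`. [cite: Maynard2016LargeGaps, §6 display (6.16)] -/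
def nuTail (k : ℕ) (ε : ℝ) (x m q : ℕ) : ℝ :=
  ∏ p ∈ ((badPrimes k x m q).filter (fun p => p.Prime ∧ ¬ p ∣ Pw x)).filter
      (fun p => ¬ p ≤ ⌊y ε x⌋₊),
    (1 + (coupledNu m (couplingSet k x m q) p : ℝ) / p)

/-- **`N = (∏_{w<p≤y} (1 + ν_p/p)) · B`**: the bad primes `≤ y` not dividing `P_w` lie in `(w, y]`,
and the other primes of `(w, y]` have `ν_p = 0`. [cite: Maynard2016LargeGaps, §6 display (6.16)] -/
theorem nuProdReal_eq_mul {k x m q : ℕ} (hm : 1 ≤ m) (hq : 2 ≤ q) (ε : ℝ) :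
    nuProdReal k x m q =
      (∏ p ∈ midPrimes ε x, (1 + (coupledNu m (couplingSet k x m q) p : ℝ) / p)) *
        nuTail k ε x m q := by
  unfold nuProdReal nuTail
  set S := (badPrimes k x m q).filter (fun p => p.Prime ∧ ¬ p ∣ Pw x) with hS
  rw [← Finset.prod_filter_mul_prod_filter_not S (fun p => p ≤ ⌊y ε x⌋₊)]
  congr 1
  apply Finset.prod_subset
  · intro p hp
    obtain ⟨hpS, hpy⟩ := Finset.mem_filter.1 hp
    obtain ⟨-, hpp, hpW⟩ := Finset.mem_filter.1 hpS
    have h0 := p0_le_of_not_dvd_Pw hpp hpW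
    unfold p0 at h0
    exact Finset.mem_filter.2 ⟨Finset.mem_Ioc.2 ⟨by omega, hpy⟩, hpp⟩
  · intro p hp hpn
    obtain ⟨hpp, hpW⟩ := not_dvd_Pw_of_mem_midPrimes hp
    have hpy : p ≤ ⌊y ε x⌋₊ := (Finset.mem_Ioc.1 (Finset.mem_filter.1 hp).1).2
    have hpB : p ∉ badPrimes k x m q := fun h =>
      hpn (Finset.mem_filter.2 ⟨Finset.mem_filter.2 ⟨h, hpp, hpW⟩, hpy⟩)
    have hBad : ∀ r : ℕ, r.Prime → ¬ r ∣ Pw x → r ∉ badPrimes k x m q →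
        ¬ r ∣ m ∧ couplingSet k x m q r = ∅ := fun r hr _ hB => badPrimes_spec hm hq r hr hB
    rw [coupledNu_eq_zero hBad hpp hpW hpB]
    simp

/-- `1 ≤ B`. [cite: Maynard2016LargeGaps, §6 display (6.16)] -/
theorem one_le_nuTail (k : ℕ) (ε : ℝ) (x m q : ℕ) : 1 ≤ nuTail k ε x m q := by
  unfold nuTail
  set T := ((badPrimes k x m q).filter (fun p => p.Prime ∧ ¬ p ∣ Pw x)).filter
      (fun p => ¬ p ≤ ⌊y ε x⌋₊) with hT
  calc (1 : ℝ) = ∏ _p ∈ T, (1 : ℝ) := by simp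
    _ ≤ _ := Finset.prod_le_prod (fun _ _ => zero_le_one) fun p _ => by
        have : (0 : ℝ) ≤ (coupledNu m (couplingSet k x m q) p : ℝ) / p := by positivity
        linarith

/-- `B ≤ exp(k² · #{p ∣ N'} / (⌊y⌋ + 1))`. [cite: Maynard2016LargeGaps, §6 display (6.16)] -/
theorem nuTail_le_exp (k : ℕ) (ε : ℝ) (x m q : ℕ) :
    nuTail k ε x m q ≤
      Real.exp ((k : ℝ) * k * (badModulus k x m q).primeFactors.card / (⌊y ε x⌋₊ + 1)) := by
  unfold nuTail
  set T := ((badPrimes k x m q).filter (fun p => p.Prime ∧ ¬ p ∣ Pw x)).filter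
      (fun p => ¬ p ≤ ⌊y ε x⌋₊) with hT
  set Y : ℝ := (⌊y ε x⌋₊ : ℝ) + 1 with hY
  have hY0 : 0 < Y := by positivity
  have hfac : ∀ p ∈ T, (1 + (coupledNu m (couplingSet k x m q) p : ℝ) / p) ≤
      Real.exp ((k : ℝ) * k / Y) := by
    intro p hp
    obtain ⟨-, hpy⟩ := Finset.mem_filter.1 hp
    rw [not_le] at hpy
    have hpY : Y ≤ p := by rw [hY]; exact_mod_cast hpy
    have hp0 : (0 : ℝ) < p := lt_of_lt_of_le hY0 hpY
    have hν : (coupledNu m (couplingSet k x m q) p : ℝ) ≤ k * k := by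
      exact_mod_cast coupledNu_couplingSet_le k x m q p
    calc 1 + (coupledNu m (couplingSet k x m q) p : ℝ) / p ≤ 1 + (k : ℝ) * k / Y := by
          have h1 : (coupledNu m (couplingSet k x m q) p : ℝ) / p ≤ (k : ℝ) * k / p :=
            div_le_div_of_nonneg_right hν hp0.le
          have h2 : (k : ℝ) * k / p ≤ (k : ℝ) * k / Y :=
            div_le_div_of_nonneg_left (by positivity) hY0 hpY
          linarith
      _ ≤ Real.exp ((k : ℝ) * k / Y) := by linarith [Real.add_one_le_exp ((k : ℝ) * k / Y)]
  have hcard : T.card ≤ (badModulus k x m q).primeFactors.card :=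
    (Finset.card_filter_le _ _).trans (Finset.card_filter_le _ _)
  calc ∏ p ∈ T, (1 + (coupledNu m (couplingSet k x m q) p : ℝ) / p)
      ≤ ∏ _p ∈ T, Real.exp ((k : ℝ) * k / Y) :=
        Finset.prod_le_prod (fun p _ => by positivity) hfac
    _ = Real.exp ((k : ℝ) * k / Y) ^ T.card := Finset.prod_const _
    _ ≤ Real.exp ((k : ℝ) * k / Y) ^ (badModulus k x m q).primeFactors.card :=
        pow_le_pow_right₀ (Real.one_le_exp (by positivity)) hcard
    _ = Real.exp ((k : ℝ) * k * (badModulus k x m q).primeFactors.card / (⌊y ε x⌋₊ + 1)) := by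
        rw [← Real.exp_nat_mul, hY]; ring_nf

/-! ### The local comparison `1 − (ω − 2k)/p` vs `(1 − ω/p)(1 − 1/p)^{−2k}` -/

/-- `1 − n u ≤ (1 − u)^n ≤ 1 − n u + n² u²` for `0 ≤ u ≤ 1`. [folklore] -/
private theorem one_sub_pow_bounds {u : ℝ} (hu0 : 0 ≤ u) (hu1 : u ≤ 1) (n : ℕ) :
    1 - n * u ≤ (1 - u) ^ n ∧ (1 - u) ^ n ≤ 1 - n * u + n * n * u ^ 2 := by
  constructor
  · have h := one_add_mul_le_pow (show (-2 : ℝ) ≤ -u by linarith) n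
    calc 1 - (n : ℝ) * u = 1 + n * (-u) := by ring
      _ ≤ (1 + -u) ^ n := h
      _ = (1 - u) ^ n := by ring
  · induction n with
    | zero => simp
    | succ n ih =>
      have h1u : 0 ≤ 1 - u := by linarith
      calc (1 - u) ^ (n + 1) = (1 - u) * (1 - u) ^ n := by ring
        _ ≤ (1 - u) * (1 - n * u + n * n * u ^ 2) := mul_le_mul_of_nonneg_left ih h1u
        _ ≤ 1 - (n + 1 : ℕ) * u + (n + 1 : ℕ) * (n + 1 : ℕ) * u ^ 2 := by
            push_cast
            nlinarith [mul_nonneg (mul_nonneg (Nat.cast_nonneg n) (Nat.cast_nonneg n))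
              (pow_nonneg hu0 3), sq_nonneg u, mul_nonneg (Nat.cast_nonneg n) (sq_nonneg u)]

/-- **`|(1 − (ω−2k)/p)/((1 − ω/p)(1−1/p)^{−2k}) − 1| ≤ 12 k²/p²`** for `ω ≤ 2k`, `4k ≤ p`:
the factors of (6.16) and of `𝔖_{m,q}` agree up to `1 + O(k²/p²)`. [cite: Maynard2016LargeGaps, §6 display (6.20)] -/
theorem abs_ratio_sub_one_le {k ω p : ℕ} (hω : ω ≤ 2 * k) (hkp : 4 * k ≤ p) (hp : 2 ≤ p) :
    |(1 + (2 * k - ω : ℝ) / p) * (1 - 1 / (p : ℝ)) ^ (2 * k) / (1 - (ω : ℝ) / p) - 1| ≤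
      12 * (k : ℝ) ^ 2 / (p : ℝ) ^ 2 := by
  have hp0 : (0 : ℝ) < p := by exact_mod_cast (show 0 < p by omega)
  set u : ℝ := 1 / p with hu
  have hu0 : 0 ≤ u := by positivity
  have hu1 : u ≤ 1 := by rw [hu, div_le_one hp0]; exact_mod_cast (show 1 ≤ p by omega)
  have hK : (k : ℝ) * u ≤ 1 / 4 := by
    rw [hu, mul_one_div, div_le_div_iff₀ hp0 (by norm_num : (0 : ℝ) < 4)]
    have : (4 * k : ℕ) ≤ p := hkp
    have : (4 : ℝ) * k ≤ p := by exact_mod_cast this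
    linarith
  have hωk : (ω : ℝ) ≤ 2 * k := by exact_mod_cast hω
  set K : ℝ := (k : ℝ) with hKdef
  set O : ℝ := (ω : ℝ) with hOdef
  set c : ℝ := 2 * K - O with hc
  have hc0 : 0 ≤ c := by rw [hc]; linarith
  have hc2 : c ≤ 2 * K := by rw [hc]; linarith [(Nat.cast_nonneg ω : (0 : ℝ) ≤ O)]
  set P : ℝ := (1 - u) ^ (2 * k) with hP
  obtain ⟨hPl, hPu⟩ := one_sub_pow_bounds hu0 hu1 (2 * k)
  push_cast at hPl hPu
  set e : ℝ := P - (1 - 2 * K * u) with he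
  have he0 : 0 ≤ e := by rw [he, hP]; linarith
  have he1 : e ≤ 4 * K ^ 2 * u ^ 2 := by rw [he, hP]; nlinarith
  set A : ℝ := 1 - O * u with hA
  have hA2 : 1 / 2 ≤ A := by rw [hA]; nlinarith
  have hA0 : 0 < A := by linarith
  set D : ℝ := (1 + c * u) * P with hD
  -- rewrite the expression as `D / A`
  have hexpr : (1 + (2 * k - ω : ℝ) / p) * (1 - 1 / (p : ℝ)) ^ (2 * k) / (1 - (ω : ℝ) / p) = D / A := by
    rw [hD, hA, hP, hc, hu]; ring
  rw [hexpr, div_sub_one hA0.ne', abs_div, abs_of_pos hA0]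
  have hDA : D - A = e * (1 + c * u) - 2 * K * c * u ^ 2 := by
    rw [hD, hA, he, hc]; ring
  have hcu : c * u ≤ 1 / 2 := by nlinarith
  have habs : |D - A| ≤ 6 * K ^ 2 * u ^ 2 := by
    rw [hDA, abs_le]
    constructor
    · nlinarith [mul_nonneg he0 (mul_nonneg hc0 hu0), mul_nonneg (mul_nonneg hc0 (by linarith : (0:ℝ) ≤ 2 * K - c)) (sq_nonneg u)]
    · nlinarith [mul_nonneg he0 (mul_nonneg hc0 hu0), mul_nonneg (mul_nonneg (by positivity : (0:ℝ) ≤ 2 * K) hc0) (sq_nonneg u)]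
  rw [div_le_iff₀ hA0]
  have hKu : 6 * K ^ 2 * u ^ 2 = 6 * ((k : ℝ) ^ 2 / (p : ℝ) ^ 2) := by
    rw [hu, hKdef]; field_simp
  have hq0 : 0 ≤ (k : ℝ) ^ 2 / (p : ℝ) ^ 2 := by positivity
  have e12 : 12 * (k : ℝ) ^ 2 / (p : ℝ) ^ 2 * A = (12 * A) * ((k : ℝ) ^ 2 / (p : ℝ) ^ 2) := by ring
  calc |D - A| ≤ 6 * K ^ 2 * u ^ 2 := habs
    _ = 6 * ((k : ℝ) ^ 2 / (p : ℝ) ^ 2) := hKu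
    _ ≤ (12 * A) * ((k : ℝ) ^ 2 / (p : ℝ) ^ 2) := mul_le_mul_of_nonneg_right (by linarith) hq0
    _ = 12 * (k : ℝ) ^ 2 / (p : ℝ) ^ 2 * A := e12.symm

/-! ### `∏_{w<p≤y} (1 + ν_p/p)` against `singLarge` -/

/-- The middle product equals `singLarge · R` with `|R − 1| ≤ exp(24k²/(⌊w⌋+1)) − 1`, provided
`4k ≤ ⌊w⌋ + 1`, every prime of `(w, y]` is `∤ q` and divides no `h_j − h_i`.
[cite: Maynard2016LargeGaps, §6 displays (6.16), (6.20)] -/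
theorem exists_prod_mid_eq_singLarge_mul {k x m q : ℕ} {ε : ℝ} (hk : 4 * k ≤ ⌊wFun x⌋₊ + 1)
    (hpq : ∀ p ∈ midPrimes ε x, ¬ p ∣ q)
    (hdist : ∀ p ∈ midPrimes ε x, ∀ i j : Fin k, i ≠ j → ¬ (p : ℤ) ∣ (hTuple k x j : ℤ) - hTuple k x i) :
    ∃ R : ℝ, (∏ p ∈ midPrimes ε x, (1 + (coupledNu m (couplingSet k x m q) p : ℝ) / p)) =
        singLarge k ε x m q * R ∧ |R - 1| ≤ Real.exp (24 * (k : ℝ) ^ 2 / (⌊wFun x⌋₊ + 1)) - 1 := by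
  classical
  -- the local ratios
  set r : ℕ → ℝ := fun p =>
    (1 + (2 * k - omegaMQ k x m q p : ℝ) / p) * (1 - 1 / (p : ℝ)) ^ (2 * k) /
      (1 - (omegaMQ k x m q p : ℝ) / p) with hr
  refine ⟨∏ p ∈ midPrimes ε x, r p, ?_, ?_⟩
  · rw [singLarge_eq, ← Finset.prod_mul_distrib]
    refine Finset.prod_congr rfl fun p hp => ?_
    obtain ⟨hpp, hpW⟩ := not_dvd_Pw_of_mem_midPrimes hp
    have hwp : ⌊wFun x⌋₊ < p := (Finset.mem_Ioc.1 (Finset.mem_filter.1 hp).1).1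
    have hp2k : 2 * k < p := by omega
    have hA : 0 < 1 - (omegaMQ k x m q p : ℝ) / p := one_sub_omegaMQ_div_pos k x m q hpp hp2k
    have hp1 : (1 : ℝ) < p := by exact_mod_cast hpp.one_lt
    have hP : 0 < (1 - 1 / (p : ℝ)) ^ (2 * k) := by
      apply pow_pos
      rw [sub_pos, div_lt_one (by linarith)]; exact hp1
    rw [coupledNu_couplingSet_eq hpp (hpq p hp) (hdist p hp), hr]
    have hA' := hA.ne'
    have hP' := hP.ne'
    set A := 1 - (omegaMQ k x m q p : ℝ) / p
    set P := (1 - 1 / (p : ℝ)) ^ (2 * k)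
    set C := 1 + (2 * k - omegaMQ k x m q p : ℝ) / p
    calc C = C * (A * A⁻¹) * (P * P⁻¹) := by
          rw [mul_inv_cancel₀ hA', mul_inv_cancel₀ hP', mul_one, mul_one]
      _ = A * P⁻¹ * (C * P / A) := by rw [div_eq_mul_inv]; ring
  · -- `|∏ r_p − 1| ≤ exp(Σ |r_p − 1|) − 1 ≤ exp(12k² Σ 1/p²) − 1 ≤ exp(24k²/(⌊w⌋+1)) − 1`
    have h1 : |∏ p ∈ midPrimes ε x, r p - 1| ≤
        Real.exp (∑ p ∈ midPrimes ε x, |r p - 1|) - 1 := by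
      have h := Finset.norm_prod_one_add_sub_one_le (midPrimes ε x) (fun p => r p - 1)
      simp only [add_sub_cancel, Real.norm_eq_abs] at h
      exact h
    refine h1.trans ?_
    gcongr
    have h2 : ∀ p ∈ midPrimes ε x, |r p - 1| ≤ 12 * (k : ℝ) ^ 2 * ((p : ℝ) ^ 2)⁻¹ := by
      intro p hp
      obtain ⟨hpp, -⟩ := not_dvd_Pw_of_mem_midPrimes hp
      have hwp : ⌊wFun x⌋₊ < p := (Finset.mem_Ioc.1 (Finset.mem_filter.1 hp).1).1
      have h := abs_ratio_sub_one_le (omegaMQ_le_two_mul k x m q hpp) (by omega) hpp.two_le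
      rw [hr]
      simpa [div_eq_mul_inv] using h
    calc ∑ p ∈ midPrimes ε x, |r p - 1| ≤ ∑ p ∈ midPrimes ε x, 12 * (k : ℝ) ^ 2 * ((p : ℝ) ^ 2)⁻¹ :=
          Finset.sum_le_sum h2
      _ = 12 * (k : ℝ) ^ 2 * ∑ p ∈ midPrimes ε x, ((p : ℝ) ^ 2)⁻¹ := by rw [Finset.mul_sum]
      _ ≤ 12 * (k : ℝ) ^ 2 * (2 / ((⌊wFun x⌋₊ : ℝ) + 1)) := by
          refine mul_le_mul_of_nonneg_left ?_ (by positivity)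
          have hsub : midPrimes ε x ⊆ Finset.Ioo ⌊wFun x⌋₊ (⌊y ε x⌋₊ + 1) := by
            intro p hp
            have h := Finset.mem_Ioc.1 (Finset.mem_filter.1 hp).1
            exact Finset.mem_Ioo.2 ⟨h.1, by omega⟩
          calc ∑ p ∈ midPrimes ε x, ((p : ℝ) ^ 2)⁻¹ ≤ ∑ i ∈ Finset.Ioo ⌊wFun x⌋₊ (⌊y ε x⌋₊ + 1), ((i : ℝ) ^ 2)⁻¹ :=
                Finset.sum_le_sum_of_subset_of_nonneg hsub fun i _ _ => by positivity
            _ ≤ 2 / ((⌊wFun x⌋₊ : ℝ) + 1) := sum_Ioo_inv_sq_le _ _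
      _ = 24 * (k : ℝ) ^ 2 / (⌊wFun x⌋₊ + 1) := by ring

/-! ### `N = (1 + o(1)) 𝔖^{(w,y]}_{m,q}` uniformly -/

/-- `singLarge > 0` once `2k ≤ ⌊w⌋`. [cite: Maynard2016LargeGaps, §5 display (5.2)] -/
theorem singLarge_pos {k x : ℕ} (hk : 2 * k ≤ ⌊wFun x⌋₊) (ε : ℝ) (m q : ℕ) :
    0 < singLarge k ε x m q := by
  rw [singLarge_eq]
  refine Finset.prod_pos fun p hp => ?_
  obtain ⟨hpp, -⟩ := not_dvd_Pw_of_mem_midPrimes hp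
  have hwp : ⌊wFun x⌋₊ < p := (Finset.mem_Ioc.1 (Finset.mem_filter.1 hp).1).1
  have hp1 : (1 : ℝ) < p := by exact_mod_cast hpp.one_lt
  refine mul_pos (one_sub_omegaMQ_div_pos k x m q hpp (by omega)) (inv_pos.2 (pow_pos ?_ _))
  rw [sub_pos, div_lt_one (by linarith)]; exact hp1

/-- `y < x/2` eventually (`0 < ε`): `log y ≤ (1−ε) log x`. [cite: Maynard2016LargeGaps, §2 display (2.1)] -/
theorem eventually_y_lt_half {ε : ℝ} (hε0 : 0 < ε) (hε1 : ε ≤ 1) :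
    ∀ᶠ x : ℕ in atTop, y ε x < (x : ℝ) / 2 := by
  have hT : Tendsto (fun x : ℕ => Real.log (x : ℝ)) atTop atTop :=
    Real.tendsto_log_atTop.comp tendsto_natCast_atTop_atTop
  filter_upwards [eventually_iteratedLogs, hT.eventually_ge_atTop (Real.log 2 / ε + 1),
    eventually_gt_atTop 0] with x hlogs hbig hx0
  obtain ⟨hL, hL₂, hL₃, hL₃L₂, -, -, -⟩ := hlogs
  have hx0' : (0 : ℝ) < x := by exact_mod_cast hx0
  have hly : Real.log (y ε x) ≤ (1 - ε) * Real.log x := by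
    rw [log_y]
    refine mul_le_mul_of_nonneg_left ?_ (by linarith)
    rw [div_le_iff₀ (by linarith)]
    nlinarith
  have hεL : Real.log 2 < ε * Real.log x := by
    have h1 : Real.log 2 / ε + 1 ≤ Real.log x := hbig
    have h2 : Real.log 2 / ε * ε = Real.log 2 := div_mul_cancel₀ _ hε0.ne'
    nlinarith
  have hlt : Real.log (y ε x) < Real.log ((x : ℝ) / 2) := by
    rw [Real.log_div hx0'.ne' two_ne_zero]; linarith
  exact (Real.log_lt_log_iff (Real.exp_pos _) (by positivity)).1 hlt

/-- `(log x)² ≤ y` eventually (`ε ≤ 1/2`): `log y ≥ log x · log₃ x/(2 log₂ x) ≥ 2 log₂ x`.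
[cite: Maynard2016LargeGaps, §2 display (2.1)] -/
theorem eventually_log_sq_le_y {ε : ℝ} (hε : ε ≤ 1 / 2) :
    ∀ᶠ x : ℕ in atTop, (Real.log x) ^ 2 ≤ y ε x := by
  -- `(log L)² ≤ L/4` for large `L`, at `L = log x`
  have hsq := (Real.isLittleO_pow_log_id_atTop (n := 2)).bound (show (0 : ℝ) < 1 / 4 by norm_num)
  have hreal : ∀ᶠ L : ℝ in atTop, (Real.log L) ^ 2 ≤ L / 4 := by
    filter_upwards [hsq, eventually_ge_atTop (0 : ℝ)] with L hL hL0
    rw [Real.norm_eq_abs, Real.norm_eq_abs, id, abs_of_nonneg (sq_nonneg _), abs_of_nonneg hL0] at hL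
    linarith
  have hT : Tendsto (fun x : ℕ => Real.log (x : ℝ)) atTop atTop :=
    Real.tendsto_log_atTop.comp tendsto_natCast_atTop_atTop
  filter_upwards [hT.eventually hreal, eventually_iteratedLogs] with x hx hlogs
  obtain ⟨hL, hL₂, hL₃, hL₃L₂, -, -, -⟩ := hlogs
  have hL0 : 0 < Real.log x := by linarith
  -- `log y ≥ 2 log₂ x`
  have hly : 2 * Real.log (Real.log x) ≤ Real.log (y ε x) := by
    rw [log_y]
    have h1 : (1 : ℝ) / 2 ≤ 1 - ε := by linarith
    have h2 : 4 * (Real.log (Real.log x)) ^ 2 ≤ Real.log x := by linarith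
    have h3 : 2 * Real.log (Real.log x) ≤
        (1 / 2) * (Real.log x * Real.log (Real.log (Real.log x)) / Real.log (Real.log x)) := by
      rw [mul_div_assoc', le_div_iff₀ (by linarith)]
      nlinarith
    exact h3.trans (mul_le_mul_of_nonneg_right h1 (by positivity))
  calc (Real.log x) ^ 2 = Real.exp (2 * Real.log (Real.log x)) := by
        rw [show (2 : ℝ) * Real.log (Real.log x) = Real.log ((Real.log x) ^ 2) by
          rw [Real.log_pow]; norm_num, Real.exp_log (pow_pos hL0 2)]
    _ ≤ Real.exp (Real.log (y ε x)) := Real.exp_le_exp.2 hly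
    _ = y ε x := Real.exp_log (Real.exp_pos _)

/-- **`N = (1 + o(1)) 𝔖^{(w,y]}_{m,q}` uniformly** ((6.16) + (6.20)): for `0 < ε ≤ 1/2`, `k ≥ 1`,
`η > 0`, eventually in `x`, for all `1 ≤ m ≤ x` and all primes `x/2 ≤ q ≤ x`:
`singLarge > 0` and `|N − singLarge| ≤ η · singLarge`. [cite: Maynard2016LargeGaps, §6 displays (6.16), (6.20)] -/
theorem eventually_abs_nuProdReal_sub_singLarge_le {ε : ℝ} (hε0 : 0 < ε) (hε : ε ≤ 1 / 2) (k : ℕ)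
    {η : ℝ} (hη : 0 < η) :
    ∀ᶠ x : ℕ in atTop, ∀ m q : ℕ, 1 ≤ m → m ≤ x → q.Prime → (x : ℝ) / 2 ≤ q → q ≤ x →
      0 < singLarge k ε x m q ∧
        |nuProdReal k x m q - singLarge k ε x m q| ≤ η * singLarge k ε x m q := by
  -- the two small exponents `a(x) = 24k²/(⌊w⌋+1)`, `b(x) = k² (4k²+2) (log x)/(log 2 · y)` → 0
  set Cb : ℝ := (k : ℝ) * k * ((4 * (k : ℝ) * k + 2) / Real.log 2) with hCb
  have hlog2 : 0 < Real.log 2 := Real.log_pos one_lt_two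
  have hCb0 : 0 ≤ Cb := by positivity
  have ha : Tendsto (fun x : ℕ => 24 * (k : ℝ) ^ 2 / (⌊wFun x⌋₊ + 1)) atTop (𝓝 0) := by
    have h1 : Tendsto (fun x : ℕ => ((⌊wFun x⌋₊ : ℝ) + 1)⁻¹) atTop (𝓝 0) := by
      refine tendsto_inv_atTop_zero.comp (tendsto_atTop_atTop.2 fun C => ?_)
      obtain ⟨N, hN⟩ := (eventually_le_wFun C).exists_forall_of_atTop
      exact ⟨N, fun x hx => (hN x hx).trans (Nat.lt_floor_add_one (wFun x)).le⟩
    simpa [div_eq_mul_inv] using h1.const_mul (24 * (k : ℝ) ^ 2)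
  have hb : Tendsto (fun x : ℕ => Cb * (Real.log x)⁻¹) atTop (𝓝 0) := by
    have h1 : Tendsto (fun x : ℕ => (Real.log (x : ℝ))⁻¹) atTop (𝓝 0) :=
      tendsto_inv_atTop_zero.comp (Real.tendsto_log_atTop.comp tendsto_natCast_atTop_atTop)
    simpa using h1.const_mul Cb
  have hab : Tendsto (fun x : ℕ => Real.exp (24 * (k : ℝ) ^ 2 / (⌊wFun x⌋₊ + 1) +
      Cb * (Real.log x)⁻¹) - 1) atTop (𝓝 0) := by
    have h0 := ha.add hb
    rw [add_zero] at h0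
    have h := (Real.continuous_exp.tendsto 0).comp h0
    rw [Real.exp_zero] at h
    simpa using h.sub_const 1
  filter_upwards [hab.eventually_le_const hη, eventually_le_wFun ((4 * k : ℕ) : ℝ),
    eventually_prime_dvd_Pw_of_dvd_hTuple_sub k, eventually_y_lt_half hε0 (by linarith),
    eventually_log_sq_le_y hε, eventually_hTuple_le k, eventually_ge_atTop 16, eventually_iteratedLogs]
    with x hx h4k hdvd hyx hly hH hx16 hlogs
  obtain ⟨hL, -, -, -, -, -, -⟩ := hlogs
  intro m q hm1 hm hq hq2 hqx
  have h4k' : 4 * k ≤ ⌊wFun x⌋₊ := Nat.le_floor h4k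
  have hpos := singLarge_pos (by omega : 2 * k ≤ ⌊wFun x⌋₊) ε m q
  refine ⟨hpos, ?_⟩
  have hq2' : 2 ≤ q := hq.two_le
  have hqx' : q ≤ x := by exact_mod_cast hqx
  -- primes of `(w, y]` are `< q` (as `y < x/2 ≤ q`), hence `∤ q`, and divide no `h_j − h_i`
  have hy0 : 0 ≤ y ε x := (Real.exp_pos _).le
  have hpq : ∀ p ∈ midPrimes ε x, ¬ p ∣ q := by
    intro p hp hpq
    obtain ⟨hpp, -⟩ := not_dvd_Pw_of_mem_midPrimes hp
    have hpy : p ≤ ⌊y ε x⌋₊ := (Finset.mem_Ioc.1 (Finset.mem_filter.1 hp).1).2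
    have hpq' : p = q := (Nat.prime_dvd_prime_iff_eq hpp hq).1 hpq
    have : (p : ℝ) ≤ y ε x := le_trans (by exact_mod_cast hpy) (Nat.floor_le hy0)
    rw [hpq'] at this
    linarith
  have hdist : ∀ p ∈ midPrimes ε x, ∀ i j : Fin k, i ≠ j →
      ¬ (p : ℤ) ∣ (hTuple k x j : ℤ) - hTuple k x i := by
    intro p hp i j hij h
    obtain ⟨hpp, hpW⟩ := not_dvd_Pw_of_mem_midPrimes hp
    exact hpW (hdvd i j hij p hpp h)
  obtain ⟨R, hR, hR1⟩ := exists_prod_mid_eq_singLarge_mul (m := m) (q := q) (by omega) hpq hdist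
  -- `N = singLarge · R · B`
  have hN : nuProdReal k x m q = singLarge k ε x m q * (R * nuTail k ε x m q) := by
    rw [nuProdReal_eq_mul hm1 hq2' ε, hR]; ring
  set a : ℝ := 24 * (k : ℝ) ^ 2 / (⌊wFun x⌋₊ + 1) with ha'
  set B := nuTail k ε x m q with hB
  have hB1 : 1 ≤ B := one_le_nuTail k ε x m q
  -- `B ≤ exp(b)` with `b ≤ Cb / log x`
  have hBexp : B ≤ Real.exp (Cb * (Real.log x)⁻¹) := by
    refine (nuTail_le_exp k ε x m q).trans (Real.exp_le_exp.2 ?_)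
    have hN0 : badModulus k x m q ≠ 0 := badModulus_ne_zero hm1 hq2' k x
    have hcard : ((badModulus k x m q).primeFactors.card : ℝ) ≤
        (4 * (k : ℝ) * k + 2) * Real.log x / Real.log 2 := by
      rw [le_div_iff₀ hlog2]
      exact (GreenTao2008.SharpGY.card_primeFactors_mul_log_two_le hN0).trans
        (log_badModulus_le hx16 hm hqx' hH)
    have hL0 : 0 < Real.log x := by linarith
    have hyL : (Real.log x) ^ 2 ≤ (⌊y ε x⌋₊ : ℝ) + 1 :=
      hly.trans (Nat.lt_floor_add_one (y ε x)).le
    have hY0 : (0 : ℝ) < (⌊y ε x⌋₊ : ℝ) + 1 := by positivity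
    calc (k : ℝ) * k * ((badModulus k x m q).primeFactors.card : ℝ) / ((⌊y ε x⌋₊ : ℝ) + 1)
        ≤ (k : ℝ) * k * ((4 * (k : ℝ) * k + 2) * Real.log x / Real.log 2) / (Real.log x) ^ 2 := by
          gcongr
      _ = Cb * (Real.log x)⁻¹ := by rw [hCb]; field_simp
  have hexpb : 1 ≤ Real.exp (Cb * (Real.log x)⁻¹) := Real.one_le_exp (by positivity)
  -- `|R B − 1| ≤ (e^a − 1) e^b + (e^b − 1) = e^{a+b} − 1 ≤ η`
  have hRB : |R * B - 1| ≤ Real.exp (a + Cb * (Real.log x)⁻¹) - 1 := by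
    have e1 : R * B - 1 = (R - 1) * B + (B - 1) := by ring
    rw [e1, Real.exp_add]
    refine (abs_add_le _ _).trans ?_
    rw [abs_mul, abs_of_nonneg (by linarith : (0 : ℝ) ≤ B), abs_of_nonneg (by linarith : (0 : ℝ) ≤ B - 1)]
    have hea : 0 ≤ Real.exp a - 1 := by linarith [Real.one_le_exp (show 0 ≤ a by positivity)]
    nlinarith [mul_le_mul hR1 hBexp (by linarith) hea]
  rw [hN, show singLarge k ε x m q * (R * B) - singLarge k ε x m q =
      singLarge k ε x m q * (R * B - 1) by ring, abs_mul, abs_of_pos hpos, mul_comm]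
  exact mul_le_mul_of_nonneg_right (hRB.trans hx) hpos.le

end Maynard2016

end Literature.NumberTheory.Sieve

end
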